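import Literature.NumberTheory.EllipticCurves.AnticyclotomicSignedTransferTheorem
import Literature.NumberTheory.EllipticCurves.AnticyclotomicSignedMainConjectureTransfer
import Literature.NumberTheory.EllipticCurves.AnticyclotomicSignedSelmerRelaxedEquality
import HarnessLib

/-!
# Stub S1 `stub_bdpLowerHalfRatSS` of line `bdpline` (crux `AnticyclotomicEisensteinDivisibility`,
# stmt-BirchSwinnertonDyer-20727) — the T68 side hypothesis `hEq` ("`Sel_±(K, 𝐓^ac) = Sel^{±,rel}(K, 𝐓^ac)`")
# CLOSED MODULO ONE NEW refereed named fact (Castella–Wan, proof of Thm. 6.8 / arXiv v3 Lemma 5.9)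
# and Castella–Wan Lemma 6.7 (typed)

Width seat bsd-line-sbc-p1-w3 (gen 2), `--supports stmt-BirchSwinnertonDyer-20727`. The Eisenstein-direction
transfer `SignedBaseChangeAcDivEisensteinTransfer.TransferInputs.span_pow_mul_charIdeal_le_span_sq`
(p634573) carries, besides `TransferInputs` and `hX`, the two side hypotheses `hinj` (served by
`…TransferSideInjective` modulo CW24 Lemma 6.7, and by `…CompactSignedRankOne` modulo HLV22 5.7 + LV19
1.4) and `hEq` — print's "`Sel_±(K, 𝐓^ac) = Sel^{±,rel}(K, 𝐓^ac)`" (Castella–Wan, proof of Thm. 6.8, MS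
p. 30), in the weak form "every `loc_𝔭`-image of `Sel^{ε,rel}` is a `loc_𝔭`-image of `Sel_ε`". No field of
`TransferInputs` and no typed fact delivers it: it is the one place where the print uses global duality
AT THE OTHER PRIME `𝔭̄` ("the quotient `Sel_{±,rel}/Sel_±` injects into `H¹(K_𝔭̄, 𝐓^ac)/H¹_±(K_𝔭̄, 𝐓^ac)`,
which has trivial `Λ^ac`-torsion by Proposition 3.8" + a rank count). In the journal the (i) ⟹ (ii)
rank implication is "similar" (MS p. 30: "The other implication for `Λ^ac`-ranks is similar"); the
DISPLAYED statement with proof is Lemma 5.9 of the arXiv version (arXiv:1607.02019v3 §5.3, held text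
`paper:arxiv-1607.02019` p. 20): "Assume that `Sel^{ε,ε}(K, 𝐓^ac)` has `Λ_ac`-rank `1`. Then
`Sel^{ε,ε}(K, 𝐓^ac) = Sel^{ε,rel}(K, 𝐓^ac)` and `X^{ε,str}(K, 𝐀^ac)` is a torsion `Λ_ac`-module."
THIS FILE states that lemma as ONE named fact in the tree's vocabulary (inline, to be relocated to the
Literature layer by the gate) and derives `hEq` from it and the rank-one input of the transfer
(`finrank_Λ Sel_ε = 1` ⟸ CW24 Lemma 6.7 (1), typed, + `hX`).

## Contents

* §1 NAMED FACT (definition, `Prop`, nothing asserted):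
  `castellaWan2024_proofThm68_selmerLambdaAdic_atRel_eq_sgn` — transcription of arXiv v3 Lemma 5.9 =
  journal proof of Thm. 6.8 (MS p. 30), first conclusion only (the second, "`X^{ε,str}` torsion", is a
  tree THEOREM given `X_ε` of rank one: `…XAcTorsionTransfer.TransferInputs.isFGTorsion_at_str_rel_of_hasRank`).
* §2 PROVED: `hEq_of_facts` — the hypothesis `hEq` of p634573, for every `TransferInputs` datum of a base
  change `W⁄K` in the `Setting`, modulo {the §1 fact, CW24 Lemma 6.7} given `hX`;
  `selmerLambdaAdic_atRel_eq_sgn_of_facts` — the equality itself.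
BSD / the crux / S1 are NOT proved by this file; the §1 fact is a hypothesis wherever used.

References: [CastellaWan2023] Thm. 6.8 and its proof (MS pp. 29–31), Lemma 6.7 (MS p. 28), Prop. 3.8 (MS
p. 15), Def. 5.1 (MS p. 23); arXiv:1607.02019v3 Lemma 5.9 (p. 20 of the held text, L7–L49) with its
proof (eq. (5.5)–(5.7): `loc_𝔭`, Thm. 3.1, Prop. 5.15, Lemma (str-rel), the `𝔭̄`-side duality sequence).
-/

-- D-0017: single-problem summit, the namespace repeats the problem name by design.
set_option linter.dupNamespace false
set_option autoImplicit false

noncomputable section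

open scoped Classical

universe u

namespace Summit.BirchSwinnertonDyer.BirchSwinnertonDyer.Theorems.SignedBaseChangeAcDivTransferSideEq

open NumberField IsDedekindDomain Field
open Literature.NumberTheory.EllipticCurves Literature.NumberTheory.GaloisRepresentations
open Literature.NumberTheory.EllipticCurves.AcSigned

/-! ## §1 The named fact: `Sel_ε(K, 𝐓^ac) = Sel^{ε,rel}(K, 𝐓^ac)` when `Sel_ε(K, 𝐓^ac)` has `Λ`-rank one -/

/-- **Castella–Wan 2024, proof of Thm. 6.8 (= arXiv v3 Lemma 5.9): if `Sel_±(K, 𝐓^ac)` has `Λ^ac`-rank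
one then `Sel_±(K, 𝐓^ac) = Sel^{±,rel}(K, 𝐓^ac)`; named fact.** PRINT. Journal (Math. Ann. 389 (2024),
proof of Thm. 6.8, MS p. 30): "Global duality yields … (6.12) `0 → Sel^{str,rel}(K, 𝐓^ac) →
Sel^{±,rel}(K, 𝐓^ac) —loc_𝔭→ H¹_±(K_𝔭, 𝐓^ac) → X^{rel,str} → X^{±,str} → 0`. Since `H¹_±(K_𝔭, 𝐓^ac) ≃ Λ^ac`
(see Proposition 3.8) … `Sel_±(K, 𝐓^ac) = Sel^{±,rel}(K, 𝐓^ac)`, since the quotient `Sel_{±,rel}/Sel_±`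
injects into `H¹(K_𝔭̄, 𝐓^ac)/H¹_±(K_𝔭̄, 𝐓^ac)`, which has trivial `Λ^ac`-torsion by Proposition 3.8 … The
other implication for `Λ^ac`-ranks is similar"; displayed with proof in the arXiv version
(arXiv:1607.02019v3, Lemma 5.9): "Assume that `Sel^{ε,ε}(K, 𝐓^ac)` has `Λ_ac`-rank `1`. Then
`Sel^{ε,ε}(K, 𝐓^ac) = Sel^{ε,rel}(K, 𝐓^ac)` and `X^{ε,str}(K, 𝐀^ac)` is a torsion `Λ_ac`-module" (proof:
`loc_𝔭(z^ε)` non-torsion (Thm. 3.1 = journal Cor. 6.4), `rank X^{ε,ε} = rank Sel^{ε,ε}` (Prop. 5.15 =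
journal Lemma 6.7 (1)), `rank X^{rel,ε} = 1 + rank X^{ε,str}` (journal Lemma 6.7 (2)), the `𝔭̄`-side
duality sequence `0 → Sel^{ε,ε} → Sel^{ε,rel} → H¹(K_𝔭̄, 𝐓^ac)/H¹_ε(K_𝔭̄, 𝐓^ac) → X^{ε,ε} → X^{ε,str} → 0`
and the torsion-freeness of `H¹(K_𝔭̄, 𝐓^ac)/H¹_ε` (Prop. 3.8)). Here `Sel^{𝓛_𝔭,𝓛_𝔭̄}(K, 𝐓^ac)` is the
compact Selmer group of Def. 5.1 (conditions at the two primes above `p`; `Sel_± = Sel^{±,±}`).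
Standing hypotheses of §6 (MS p. 25): `E/ℚ` of conductor `N`, `p > 3` good supersingular (`a_p = 0`), `K`
imaginary quadratic with (gen-H) and (spl). TRANSCRIBED in the special case and binders of the sibling
facts `castellaWan2024_cor64_isLocNonTorsionAt` / `castellaWan2024_lemma67_finrank_torsionCharIdeal`
(`AcSigned.Setting` — adds `p ∤ h_K` —, `N = N_E`, `N⁻ = 1` = `SatisfiesHeegnerHypothesis N K`, `3 < p`
VERBATIM; flags `CW24-local-condition`, `HLV-vs-Kob-layers`, `Shapiro`/`lim-m`, `tot-ram-via-h_K` of the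
`AnticyclotomicSigned*` series) on the tree's carriers: for every topological generator `γ` and sign `ε`,
if `finrank_Λ (selmerLambdaAdic (W⁄K) p κ γ (fun _ ↦ .sgn ε)) = 1` (module structure
`selmerLambdaAdic.moduleOfGen`, `T = γ − 1`) then the compact Selmer group with the signed condition at
the `Setting`'s first prime `𝔭` and NO condition at `𝔭'` (`PCond.at 𝔭' .rel (.sgn ε)` = Castella–Wan's
`Sel^{±,rel}` for `𝔭 ↔ ι_p`) EQUALS `Sel_ε(K, 𝐓^ac)` as subgroups of `∏_{n,m} H¹(K_n, E[p^m])` (the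
statement with `𝔭, 𝔭'` exchanged is the same fact for the conjugate embedding). Only the FIRST printed
conclusion is transcribed (the second, "`X^{ε,str}` is torsion", is the tree theorem
`SignedBaseChangeAcDivXAcTorsionTransfer.TransferInputs.isFGTorsion_at_str_rel_of_hasRank` given `X_ε` of
rank one). WEAKER than print only by specialisation. Reading flag `journal-similar`: in the journal the
equality is spelled out under the hypotheses of Thm. 6.8 (ii) and the rank-one direction is "similar";
the arXiv v3 lemma is the displayed rank-one form. NOT usable at `p = 3` (printed `p > 3`).
[cite: CastellaWan2023, proof of Thm. 6.8 (MS p. 30), Thm. 6.8, Lemma 6.7, Prop. 3.8, Def. 5.1, §6 standing hypotheses (MS pp. 15, 23, 25, 28–31); arXiv:1607.02019v3 Lemma 5.9 and its proof]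
[file NumberTheory/EllipticCurves/AnticyclotomicSignedMainConjectureTransfer] -/
def castellaWan2024_proofThm68_selmerLambdaAdic_atRel_eq_sgn (N : ℕ) (W : WeierstrassCurve ℚ)
    [W.IsGloballyMinimal] (K : Type) [Field K] [NumberField K] (p : ℕ) [Fact p.Prime]
    (κ : ZpExtension K p) (𝔭 𝔭' : HeightOneSpectrum (𝓞 K)) : Prop :=
  ∀ (_ : Setting W K p κ 𝔭 𝔭'), (W.conductorNorm ℤ : ℕ) = N → SatisfiesHeegnerHypothesis N K →
    3 < p → ∀ (γ : absoluteGaloisGroup K) (hγ : κ.IsTopGenerator γ) (ε : ℤˣ),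
    (letI := selmerLambdaAdic.moduleOfGen (W.baseChange K) p κ γ hγ (fun _ ↦ PCond.sgn ε)
     Module.finrank (IwasawaAlgebra p) (selmerLambdaAdic (W.baseChange K) p κ γ (fun _ ↦ .sgn ε)) = 1) →
    selmerLambdaAdic (W.baseChange K) p κ γ (PCond.at 𝔭' .rel (.sgn ε)) =
      selmerLambdaAdic (W.baseChange K) p κ γ (fun _ ↦ .sgn ε)

/-! ## §2 `hEq` of the Eisenstein-direction transfer, modulo the fact and CW24 Lemma 6.7 -/

section Facts

variable {N : ℕ} {W : WeierstrassCurve ℚ} [W.IsGloballyMinimal] {K : Type} [Field K]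
  [NumberField K] {p : ℕ} [Fact p.Prime] {κ : ZpExtension K p} {𝔭 𝔭' : HeightOneSpectrum (𝓞 K)}

/-- **`Sel^{ε,rel}(K, 𝐓^ac) = Sel_ε(K, 𝐓^ac)`** for a base change `W⁄K` in the `Setting`, GRANTED the fact
`castellaWan2024_proofThm68_selmerLambdaAdic_atRel_eq_sgn` and CW24 Lemma 6.7 (typed,
`castellaWan2024_lemma67_finrank_torsionCharIdeal`: `finrank Sel_ε = finrank X_ε`), from the rank-one input
`hX : X.HasRank (W⁄K) p κ ∅ (sgn ε) hγ 1` of the transfer (Longo–Vigni 2019 Thm. 1.4 on the refereed road).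
[cite: CastellaWan2023, proof of Thm. 6.8 (MS p. 30) and Lemma 6.7 (1) (MS p. 28); arXiv:1607.02019v3 Lemma 5.9] -/
theorem selmerLambdaAdic_atRel_eq_sgn_of_facts
    (h59 : castellaWan2024_proofThm68_selmerLambdaAdic_atRel_eq_sgn N W K p κ 𝔭 𝔭')
    (h67 : castellaWan2024_lemma67_finrank_torsionCharIdeal N W K p κ 𝔭 𝔭')
    (hS : Setting W K p κ 𝔭 𝔭') (hN : (W.conductorNorm ℤ : ℕ) = N) (hHg : SatisfiesHeegnerHypothesis N K)
    (hp : 3 < p) {γ : absoluteGaloisGroup K} (hγ : κ.IsTopGenerator γ) (ε : ℤˣ)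
    (hX : X.HasRank (W.baseChange K) p κ ∅ (fun _ ↦ .sgn ε) hγ 1) :
    selmerLambdaAdic (W.baseChange K) p κ γ (PCond.at 𝔭' .rel (.sgn ε)) =
      selmerLambdaAdic (W.baseChange K) p κ γ (fun _ ↦ .sgn ε) := by
  refine h59 hS hN hHg hp γ hγ ε ?_
  obtain ⟨h1, -, -⟩ := h67 hS hN hHg hp γ hγ ε
  rw [h1]
  exact hX.2

/-- **`hEq` of the Eisenstein-direction transfer: every `loc_𝔭`-image of `Sel^{ε,rel}(K, 𝐓^ac)` is a
`loc_𝔭`-image of `Sel_ε(K, 𝐓^ac)`** — for every `TransferInputs` prime data `(𝔭, 𝔭')` of a base change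
`W⁄K` in the `Setting`, GRANTED the fact `castellaWan2024_proofThm68_selmerLambdaAdic_atRel_eq_sgn` and
CW24 Lemma 6.7, given the transfer's rank-one input `hX`. With the two compact groups EQUAL, the witness
is the same norm-compatible family and the two localisations agree definitionally. Exactly the hypothesis
`hEq` of `SignedBaseChangeAcDivEisensteinTransfer.TransferInputs.span_pow_mul_charIdeal_le_span_sq`
(p634573). [cite: CastellaWan2023, proof of Thm. 6.8 (MS p. 30); arXiv:1607.02019v3 Lemma 5.9] -/
theorem hEq_of_facts
    (h59 : castellaWan2024_proofThm68_selmerLambdaAdic_atRel_eq_sgn N W K p κ 𝔭 𝔭')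
    (h67 : castellaWan2024_lemma67_finrank_torsionCharIdeal N W K p κ 𝔭 𝔭')
    (hS : Setting W K p κ 𝔭 𝔭') (hN : (W.conductorNorm ℤ : ℕ) = N) (hHg : SatisfiesHeegnerHypothesis N K)
    (hp : 3 < p) {γ : absoluteGaloisGroup K} (hγ : κ.IsTopGenerator γ) {h𝔭 : IsNonsplitIn κ 𝔭}
    {γ𝔭 : absoluteGaloisGroup (𝔭.adicCompletion K)}
    {hγ𝔭 : κ (resGalOfEmb (closureEmb (K := K) (𝔭.adicCompletion K)) γ𝔭) = κ γ}
    (h𝔭𝔭' : 𝔭 ≠ 𝔭') {h𝔭p : ((p : ℕ) : 𝓞 K) ∈ 𝔭.asIdeal} (ε : ℤˣ)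
    (hX : X.HasRank (W.baseChange K) p κ ∅ (fun _ ↦ .sgn ε) hγ 1) :
    ∀ x' : selmerLambdaAdic (W.baseChange K) p κ γ (PCond.at 𝔭' .rel (.sgn ε)),
      ∃ x : selmerLambdaAdic (W.baseChange K) p κ γ (fun _ ↦ .sgn ε),
        locSignedAt (W.baseChange K) p κ 𝔭 h𝔭 γ γ𝔭 hγ𝔭 (fun _ ↦ .sgn ε) ε rfl h𝔭p x =
          locSignedAt (W.baseChange K) p κ 𝔭 h𝔭 γ γ𝔭 hγ𝔭 (PCond.at 𝔭' .rel (.sgn ε)) ε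
            (PCond.at_of_ne .rel (.sgn ε) h𝔭𝔭') h𝔭p x' := by
  have heq := selmerLambdaAdic_atRel_eq_sgn_of_facts h59 h67 hS hN hHg hp hγ ε hX
  intro x'
  exact ⟨⟨x'.1, heq ▸ x'.2⟩, Subtype.ext rfl⟩

end Facts


/-! ## §3 Concordance with the Literature fact of record (appended)

The same printed sentence was typed, minutes earlier and from the journal MS, by the width seat
bsd-line-sbc-p1-w2 (gen 5) as the LITERATURE fact
`AcSigned.castellaWan2024_proofThm68_selmerRel_le_selmerSgn` (file
`Literature/NumberTheory/EllipticCurves/AnticyclotomicSignedSelmerRelaxedEquality.lean`, p636148) — with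
the binders of `castellaWan2024_proofThm68_transferInputs` (embedding datum `ι` inducing `𝔭`, the newform `f`),
BOTH rank hypotheses of Thm. 6.8 (i) (`finrank Sel_ε = 1` and `X.HasRank … 1`) and the conclusion as the
CONTAINMENT `Sel^{ε,rel} ≤ Sel_ε`. That is the fact OF RECORD (Literature-homed, journal wording); the §1
statement of this file (`…selmerLambdaAdic_atRel_eq_sgn`: no `ι`/`f`, only the `Sel_ε` rank hypothesis,
conclusion an equality) is the arXiv-v3-Lemma-5.9 form, IMPLIES it (below), and is kept only because landed
declarations are append-only. Consumers should take the Literature fact; `hEq` in its currency follows. -/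

section Concordance

variable {N : ℕ} [NeZero N] {W : WeierstrassCurve ℚ} [W.IsGloballyMinimal] {K : Type} [Field K]
  [NumberField K] {p : ℕ} [Fact p.Prime] {κ : ZpExtension K p} {𝔭 𝔭' : HeightOneSpectrum (𝓞 K)}

/-- The §1 statement (arXiv v3 Lemma 5.9 form: hypothesis `finrank Sel_ε = 1` only, conclusion an
equality) IMPLIES the Literature fact of record `AcSigned.castellaWan2024_proofThm68_selmerRel_le_selmerSgn`
(journal form: extra binders `ι`, `f`, `X.HasRank … 1`; conclusion `≤`). Bookkeeping.
[cite: CastellaWan2023, proof of Thm. 6.8 (MS p. 30)] -/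
theorem selmerRel_le_selmerSgn_of_atRel_eq_sgn
    (h59 : castellaWan2024_proofThm68_selmerLambdaAdic_atRel_eq_sgn N W K p κ 𝔭 𝔭') :
    castellaWan2024_proofThm68_selmerRel_le_selmerSgn N W K p κ 𝔭 𝔭' := by
  intro hS ι f _ hN hHg hp _ γ hγ ε hrk _
  exact (h59 hS hN hHg hp γ hγ ε hrk).le

/-- **`Sel^{ε,rel}(K, 𝐓^ac) = Sel_ε(K, 𝐓^ac)` from the Literature fact of record**
(`AcSigned.castellaWan2024_proofThm68_selmerRel_le_selmerSgn`, p636148) and CW24 Lemma 6.7 (typed), given an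
embedding datum `ι` inducing `𝔭`, the newform `f` of `W`, and the transfer's rank-one input `hX` — the
converse containment being the tree theorem `selmerLambdaAdic_sgn_le_at_rel`.
[cite: CastellaWan2023, proof of Thm. 6.8 (MS p. 30) and Lemma 6.7 (1) (MS p. 28)] -/
theorem selmerLambdaAdic_atRel_eq_sgn_of_literature
    (hRel : castellaWan2024_proofThm68_selmerRel_le_selmerSgn N W K p κ 𝔭 𝔭')
    (h67 : castellaWan2024_lemma67_finrank_torsionCharIdeal N W K p κ 𝔭 𝔭')
    (hS : Setting W K p κ 𝔭 𝔭') (ι : PadicAlgCl p ≃+* ℂ) {f : CuspForm (CongruenceSubgroup.Gamma0 N) 2}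
    (hf : ModularForms.IsNewformOf W f) (hN : (W.conductorNorm ℤ : ℕ) = N)
    (hHg : SatisfiesHeegnerHypothesis N K) (hp : 3 < p)
    (hι : ∀ (w : InfinitePlace K) (k : 𝓞 K), k ∈ 𝔭.asIdeal ↔ ‖ι.symm (w.embedding (k : K))‖ < 1)
    {γ : absoluteGaloisGroup K} (hγ : κ.IsTopGenerator γ) (ε : ℤˣ)
    (hX : X.HasRank (W.baseChange K) p κ ∅ (fun _ ↦ .sgn ε) hγ 1) :
    selmerLambdaAdic (W.baseChange K) p κ γ (PCond.at 𝔭' .rel (.sgn ε)) =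
      selmerLambdaAdic (W.baseChange K) p κ γ (fun _ ↦ .sgn ε) := by
  refine le_antisymm ?_ (selmerLambdaAdic_sgn_le_at_rel (W.baseChange K) p κ γ 𝔭' ε)
  refine hRel hS ι hf hN hHg hp hι γ hγ ε ?_ hX
  obtain ⟨h1, -, -⟩ := h67 hS hN hHg hp γ hγ ε
  rw [h1]
  exact hX.2

/-- **`hEq` of the Eisenstein-direction transfer (p634573) in the currency of the Literature fact of
record** `AcSigned.castellaWan2024_proofThm68_selmerRel_le_selmerSgn` (+ CW24 Lemma 6.7, typed): every
`loc_𝔭`-image of `Sel^{ε,rel}(K, 𝐓^ac)` is a `loc_𝔭`-image of `Sel_ε(K, 𝐓^ac)`, for every `TransferInputs`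
prime data `(𝔭, 𝔭')` of a base change `W⁄K` in the `Setting` with an embedding datum `ι` inducing `𝔭`,
given the transfer's rank-one input `hX`. [cite: CastellaWan2023, proof of Thm. 6.8 (MS p. 30)] -/
theorem hEq_of_literature
    (hRel : castellaWan2024_proofThm68_selmerRel_le_selmerSgn N W K p κ 𝔭 𝔭')
    (h67 : castellaWan2024_lemma67_finrank_torsionCharIdeal N W K p κ 𝔭 𝔭')
    (hS : Setting W K p κ 𝔭 𝔭') (ι : PadicAlgCl p ≃+* ℂ) {f : CuspForm (CongruenceSubgroup.Gamma0 N) 2}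
    (hf : ModularForms.IsNewformOf W f) (hN : (W.conductorNorm ℤ : ℕ) = N)
    (hHg : SatisfiesHeegnerHypothesis N K) (hp : 3 < p)
    (hι : ∀ (w : InfinitePlace K) (k : 𝓞 K), k ∈ 𝔭.asIdeal ↔ ‖ι.symm (w.embedding (k : K))‖ < 1)
    {γ : absoluteGaloisGroup K} (hγ : κ.IsTopGenerator γ) {h𝔭 : IsNonsplitIn κ 𝔭}
    {γ𝔭 : absoluteGaloisGroup (𝔭.adicCompletion K)}
    {hγ𝔭 : κ (resGalOfEmb (closureEmb (K := K) (𝔭.adicCompletion K)) γ𝔭) = κ γ}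
    (h𝔭𝔭' : 𝔭 ≠ 𝔭') {h𝔭p : ((p : ℕ) : 𝓞 K) ∈ 𝔭.asIdeal} (ε : ℤˣ)
    (hX : X.HasRank (W.baseChange K) p κ ∅ (fun _ ↦ .sgn ε) hγ 1) :
    ∀ x' : selmerLambdaAdic (W.baseChange K) p κ γ (PCond.at 𝔭' .rel (.sgn ε)),
      ∃ x : selmerLambdaAdic (W.baseChange K) p κ γ (fun _ ↦ .sgn ε),
        locSignedAt (W.baseChange K) p κ 𝔭 h𝔭 γ γ𝔭 hγ𝔭 (fun _ ↦ .sgn ε) ε rfl h𝔭p x =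
          locSignedAt (W.baseChange K) p κ 𝔭 h𝔭 γ γ𝔭 hγ𝔭 (PCond.at 𝔭' .rel (.sgn ε)) ε
            (PCond.at_of_ne .rel (.sgn ε) h𝔭𝔭') h𝔭p x' := by
  have heq := selmerLambdaAdic_atRel_eq_sgn_of_literature hRel h67 hS ι hf hN hHg hp hι hγ ε hX
  intro x'
  exact ⟨⟨x'.1, heq ▸ x'.2⟩, Subtype.ext rfl⟩

end Concordance

end Summit.BirchSwinnertonDyer.BirchSwinnertonDyer.Theorems.SignedBaseChangeAcDivTransferSideEq

end
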